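import Summits.CriticalPhenomena.PercolationContinuityZ3.Theses.PercLowPointHalfSpace
import Summits.CriticalPhenomena.PercolationContinuityZ3.Theorems.TallClusterMassBound.Negative.MassExponentFamily
import Summits.CriticalPhenomena.PercolationContinuityZ3.Theorems.PercLowPointHalfSpaceTallClusterMassBoundWallArmPartial
import Summits.CriticalPhenomena.PercolationContinuityZ3.Theorems.PercLowPointHalfSpaceTallClusterMassBoundAccessibleDefs
import Summits.CriticalPhenomena.PercolationContinuityZ3.Theorems.PercLowPointHalfSpaceTallClusterMassBoundStubAccTwoArm
import Summits.CriticalPhenomena.PercolationContinuityZ3.Theorems.PercLowPointHalfSpaceTallClusterMassBoundStubSkeletonSum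

/-!
# `TallClusterMassBound` (stmt-CriticalPhenomena-0912), line `Sketch` (accessible-skeleton-overhang) —
# the glue: a boundary rate bounds the accessible skeleton; skeleton + overhang give the crux

The sorry-free composition of the registered skeleton `Cruxes/TallClusterMassBound/Lines/Sketch.lean` with its
hypotheses made explicit, so that the line's exact exchange rate is importable (nothing here asserts the crux):

* `accessibleSum_le_of_rate` — **a rate for Barsky–Grimmett–Newman bounds the skeleton**: for EVERY parameter `p`,
  a wall one-arm rate `π_p(k) ≤ C₀ k^{-a}` (`k ≥ 1`, `0 < a ≤ 1`) gives `Σ_{x ∈ B_r} P_p(acc x) ≤ C r^{3-2a}` — the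
  card's `AccessibleFromBoundaryRate`, from the landed stubs `stub_accTwoArm` (accessible points are doubly
  wall-rooted, `P_p(acc x) ≤ π_p(k)²` for `‖x‖∞ ≥ 2k+1`) and `stub_skeletonSum` (shell bookkeeping).
* `accessibleMass_le_of_twoSided` — with a TWO-SIDED power law `c r^{-b} ≤ π_s(r) ≤ C₀ r^{-a}` at `p_c(ℤ³)` and
  `b + 1/4 ≤ 2a`, the accessible mass of a tall wall cluster is `≤ C r^{11/4} π_s(r)` (the registered stub
  `stub_wallArmTwoSided` is exactly this hypothesis; it contains crux C `QuantitativeBGN` with rate `a ≥ 1/4`).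
* `massBoundAt_of_accessible_of_overhang` — skeleton bound + overhang bound ⇒ `MassBoundAt p_c (11/4)` (union bound).
* `tallClusterMassBound_of_wallArmTwoSided_of_overhangMassBound` — the line's composition with its two OPEN stubs as
  hypotheses: (two-sided wall-arm power law) → (overhang mass bound) → `TallClusterMassBound`.

Lead a1 of the line (2026-08-16). The two open hypotheses are recorded, with the reasons they are open, in
`Cruxes/TallClusterMassBound/Lines/Sketch.lean` and the line dossier.
-/

noncomputable section

open MeasureTheory Finset
open Literature.Probability.Percolation Literature.Probability.LatticeModels
open Summit.CriticalPhenomena.PercolationContinuityZ3.Theses.PercLowPointHalfSpace (TallClusterMassBound)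
open Summit.CriticalPhenomena.PercolationContinuityZ3.Theorems.TallClusterMassBound.Negative

namespace Summit.CriticalPhenomena.PercolationContinuityZ3.Theorems.TallClusterMassBound.AccessibleSkeleton

/-- `P_p(acc x) ≤ 1`. [folklore] -/
theorem real_acc_le_one (p : unitInterval) (x : V3) : (Pp p).real (acc x) ≤ 1 := measureReal_le_one

/-- `P_p(acc x ∩ arm_r) ≤ P_p(acc x)`. [folklore] -/
theorem real_acc_inter_arm_le (p : unitInterval) (x : V3) (r : ℕ) :
    (Pp p).real (acc x ∩ arm r) ≤ (Pp p).real (acc x) :=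
  measureReal_mono Set.inter_subset_left

/-- **A wall one-arm rate bounds the accessible skeleton** (the card's `AccessibleFromBoundaryRate`, for every
parameter `p`): if `π_p(k) ≤ C₀ k^{-a}` for all `k ≥ 1` with `0 < a ≤ 1`, then
`Σ_{x ∈ B_r} P_p(acc x) ≤ C r^{3-2a}` for all `r ≥ 1`. From `stub_accTwoArm` (`P_p(acc x) ≤ π_p(k)²` for
`‖x‖∞ ≥ 2k+1`) and `stub_skeletonSum`. At `p_c(ℤ³)` with the conjectured `a = x_s ≈ 0.975` this is `≍ r^{1.05}`
(MC acc|tall · P(tall) slopes agree, kit j009137); rigorously no rate `a > 0` is known (crux C). [folklore] -/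
theorem accessibleSum_le_of_rate (p : unitInterval) {a C₀ : ℝ} (ha : 0 < a) (ha1 : a ≤ 1)
    (hup : ∀ k : ℕ, 1 ≤ k → armProb p k ≤ C₀ * (k : ℝ) ^ (-a)) :
    ∃ C : ℝ, ∀ r : ℕ, 1 ≤ r → ∑ x ∈ box 3 r, (Pp p).real (acc x) ≤ C * (r : ℝ) ^ (3 - 2 * a) := by
  have hC₀ : 0 ≤ C₀ := by
    have h1 := hup 1 le_rfl
    have hπ := armProb_nonneg p 1
    simp only [Nat.cast_one, Real.one_rpow, mul_one] at h1
    linarith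
  obtain ⟨C, hCsum⟩ := stub_skeletonSum a C₀ ha ha1 hC₀
  exact ⟨C, hCsum (fun x => (Pp p).real (acc x)) (armProb p) (fun x => measureReal_nonneg)
    (fun x => real_acc_le_one p x) (fun k => armProb_nonneg p k)
    (fun k x _ hkx => stub_accTwoArm p k x hkx) hup⟩

/-- **Two-sided wall-arm power law ⇒ accessible mass bound.** If `c r^{-b} ≤ π_s(r) ≤ C₀ r^{-a}` for all `r ≥ 1`
at `p_c(ℤ³)`, with `0 < a ≤ 1`, `0 < c` and `b + 1/4 ≤ 2a`, then
`Σ_{x ∈ B_r} P(acc x ∩ arm_ℍ(0,r)) ≤ C r^{11/4} π_s(r)`: drop `arm_r`, use `accessibleSum_le_of_rate`, and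
`r^{3-2a} ≤ r^{11/4-b} ≤ c⁻¹ r^{11/4} π_s(r)`. The hypothesis is verbatim the registered open stub
`stub_wallArmTwoSided` of the line. [folklore] -/
theorem accessibleMass_le_of_twoSided {a b C₀ c : ℝ} (ha : 0 < a) (ha1 : a ≤ 1) (hc : 0 < c)
    (hab : b + 1 / 4 ≤ 2 * a)
    (hup : ∀ r : ℕ, 1 ≤ r → armProb (criticalProbI 3) r ≤ C₀ * (r : ℝ) ^ (-a))
    (hlow : ∀ r : ℕ, 1 ≤ r → c * (r : ℝ) ^ (-b) ≤ armProb (criticalProbI 3) r) :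
    ∃ C : ℝ, ∀ r : ℕ, 1 ≤ r →
      ∑ x ∈ box 3 r, (Pp (criticalProbI 3)).real (acc x ∩ arm r) ≤
        C * (r : ℝ) ^ ((11 : ℝ) / 4) * armProb (criticalProbI 3) r := by
  obtain ⟨C, hsum⟩ := accessibleSum_le_of_rate (criticalProbI 3) ha ha1 hup
  refine ⟨max C 0 / c, fun r hr => ?_⟩
  have hr0 : (0 : ℝ) < r := by exact_mod_cast hr
  have hr1 : (1 : ℝ) ≤ r := by exact_mod_cast hr
  have hπ := hlow r hr
  have h1 : ∑ x ∈ box 3 r, (Pp (criticalProbI 3)).real (acc x ∩ arm r) ≤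
      max C 0 * (r : ℝ) ^ ((11 : ℝ) / 4 - b) := by
    calc ∑ x ∈ box 3 r, (Pp (criticalProbI 3)).real (acc x ∩ arm r)
        ≤ ∑ x ∈ box 3 r, (Pp (criticalProbI 3)).real (acc x) :=
          Finset.sum_le_sum fun x _ => real_acc_inter_arm_le _ x r
      _ ≤ C * (r : ℝ) ^ (3 - 2 * a) := hsum r hr
      _ ≤ max C 0 * (r : ℝ) ^ (3 - 2 * a) :=
          mul_le_mul_of_nonneg_right (le_max_left _ _) (Real.rpow_nonneg hr0.le _)
      _ ≤ max C 0 * (r : ℝ) ^ ((11 : ℝ) / 4 - b) :=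
          mul_le_mul_of_nonneg_left (Real.rpow_le_rpow_of_exponent_le hr1 (by linarith)) (le_max_right _ _)
  have h2 : (r : ℝ) ^ ((11 : ℝ) / 4 - b) ≤ (r : ℝ) ^ ((11 : ℝ) / 4) * armProb (criticalProbI 3) r / c := by
    rw [Real.rpow_sub hr0, div_eq_mul_inv, le_div_iff₀ hc]
    have hneg : ((r : ℝ) ^ b)⁻¹ = (r : ℝ) ^ (-b) := by rw [Real.rpow_neg hr0.le]
    rw [hneg]
    calc (r : ℝ) ^ ((11 : ℝ) / 4) * (r : ℝ) ^ (-b) * c = (r : ℝ) ^ ((11 : ℝ) / 4) * (c * (r : ℝ) ^ (-b)) := by ring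
      _ ≤ (r : ℝ) ^ ((11 : ℝ) / 4) * armProb (criticalProbI 3) r :=
          mul_le_mul_of_nonneg_left hπ (Real.rpow_nonneg hr0.le _)
  calc ∑ x ∈ box 3 r, (Pp (criticalProbI 3)).real (acc x ∩ arm r)
      ≤ max C 0 * (r : ℝ) ^ ((11 : ℝ) / 4 - b) := h1
    _ ≤ max C 0 * ((r : ℝ) ^ ((11 : ℝ) / 4) * armProb (criticalProbI 3) r / c) :=
        mul_le_mul_of_nonneg_left h2 (le_max_right _ _)
    _ = max C 0 / c * (r : ℝ) ^ ((11 : ℝ) / 4) * armProb (criticalProbI 3) r := by ring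

/-- The union bound `P(conn x ∩ arm_r) ≤ P(acc x ∩ arm_r) + P((conn x ∖ acc x) ∩ arm_r)`: a point of the tall cluster is
accessible or an overhang. [folklore] -/
theorem real_conn_inter_arm_le_acc_add_overhang (p : unitInterval) (x : V3) (r : ℕ) :
    (Pp p).real (conn x ∩ arm r) ≤ (Pp p).real (acc x ∩ arm r) + (Pp p).real ((conn x \ acc x) ∩ arm r) := by
  refine le_trans (measureReal_mono ?_) (measureReal_union_le _ _)
  intro ω hω
  by_cases h : ω ∈ acc x
  · exact Or.inl ⟨h, hω.2⟩
  · exact Or.inr ⟨⟨hω.1, h⟩, hω.2⟩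

/-- **Skeleton + overhang ⇒ `MassBoundAt p_c (11/4)`** (the card's `skeleton_overhang_split`, constants add). [folklore] -/
theorem massBoundAt_of_accessible_of_overhang {CA CO : ℝ}
    (hA : ∀ r : ℕ, 1 ≤ r → ∑ x ∈ box 3 r, (Pp (criticalProbI 3)).real (acc x ∩ arm r) ≤
      CA * (r : ℝ) ^ ((11 : ℝ) / 4) * armProb (criticalProbI 3) r)
    (hO : ∀ r : ℕ, 1 ≤ r → ∑ x ∈ box 3 r, (Pp (criticalProbI 3)).real ((conn x \ acc x) ∩ arm r) ≤
      CO * (r : ℝ) ^ ((11 : ℝ) / 4) * armProb (criticalProbI 3) r) :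
    MassBoundAt (criticalProbI 3) ((11 : ℝ) / 4) := by
  refine ⟨CA + CO, fun r hr => ?_⟩
  unfold mass
  calc ∑ x ∈ box 3 r, (Pp (criticalProbI 3)).real (conn x ∩ arm r)
      ≤ ∑ x ∈ box 3 r, ((Pp (criticalProbI 3)).real (acc x ∩ arm r) +
          (Pp (criticalProbI 3)).real ((conn x \ acc x) ∩ arm r)) :=
        Finset.sum_le_sum fun x _ => real_conn_inter_arm_le_acc_add_overhang _ x r
    _ = ∑ x ∈ box 3 r, (Pp (criticalProbI 3)).real (acc x ∩ arm r) +
          ∑ x ∈ box 3 r, (Pp (criticalProbI 3)).real ((conn x \ acc x) ∩ arm r) := Finset.sum_add_distrib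
    _ ≤ CA * (r : ℝ) ^ ((11 : ℝ) / 4) * armProb (criticalProbI 3) r +
          CO * (r : ℝ) ^ ((11 : ℝ) / 4) * armProb (criticalProbI 3) r := add_le_add (hA r hr) (hO r hr)
    _ = (CA + CO) * (r : ℝ) ^ ((11 : ℝ) / 4) * armProb (criticalProbI 3) r := by ring

/-- **The line's composition with its two open stubs as hypotheses** (registered closed sub-goal of the line `Sketch`):
a two-sided power law for the wall one-arm at `p_c(ℤ³)` with `b + 1/4 ≤ 2a` (stub `stub_wallArmTwoSided`, which
contains crux C `QuantitativeBGN` with rate `a ≥ 1/4`) and the overhang mass bound (stub `stub_overhangMassBound`,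
B's residue inside the line) together imply the crux `TallClusterMassBound`. The other two stubs of the skeleton
(`stub_accTwoArm`, `stub_skeletonSum`) are landed and used inside. [folklore] -/
theorem tallClusterMassBound_of_wallArmTwoSided_of_overhangMassBound :
    (∃ a b C₀ c : ℝ, 0 < a ∧ a ≤ 1 ∧ 0 < c ∧ b + 1 / 4 ≤ 2 * a ∧
      (∀ r : ℕ, 1 ≤ r → armProb (criticalProbI 3) r ≤ C₀ * (r : ℝ) ^ (-a)) ∧
      (∀ r : ℕ, 1 ≤ r → c * (r : ℝ) ^ (-b) ≤ armProb (criticalProbI 3) r)) →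
    (∃ C : ℝ, ∀ r : ℕ, 1 ≤ r →
      ∑ x ∈ box 3 r, (Pp (criticalProbI 3)).real ((conn x \ acc x) ∩ arm r) ≤
        C * (r : ℝ) ^ ((11 : ℝ) / 4) * armProb (criticalProbI 3) r) →
    TallClusterMassBound := by
  rintro ⟨a, b, C₀, c, ha, ha1, hc, hab, hup, hlow⟩ ⟨CO, hO⟩
  obtain ⟨CA, hA⟩ := accessibleMass_le_of_twoSided ha ha1 hc hab hup hlow
  exact tallClusterMassBound_iff.2 (massBoundAt_of_accessible_of_overhang hA hO)

end Summit.CriticalPhenomena.PercolationContinuityZ3.Theorems.TallClusterMassBound.AccessibleSkeleton
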